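import Summits.AtomisticToContinuum.Crystallization.Theorems.FrustratedLawDichotomyAperiodicGapRecordJunctionFourSectorQuot
import Summits.AtomisticToContinuum.Crystallization.Theorems.FrustratedLawDichotomyStrainedPatchPairTubeCollar

/-!
# FrustratedLawDichotomy · crux `AperiodicFrustratedLawGap` (stmt-AtomisticToContinuum-27623) — THE SECTOR JUNCTIONS AT A GENERIC DENSE-SIDE
# TABLE `stepPair 𝓡 B₁ B₂`, read at the `26/5` core (so they give the RIM), and the COLLARED cut of record (lens-5 NODE 100b «Collar L2.9»,
# `…StrainedPatchPairTubeCollar`) with its (N∣𝔇′)ᴸ / (N∣𝔅lo) cells in the INSTRUMENTED kernel-cut form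
# (decomp-a2c hand 2, generation 43; structural #36 = the H-currency-free half of the collar edition of #32/#35; DEF-FREE)

NODE 100b puts the length collar `relConeLenBy 2 ℓc βf₁ sf₁ (1/25)` (`ℓc = 29/10` of record, critic row 1617 (2)) on the door sector 𝔇′ only and glues it to the
band table by the GENERIC step `stepPair 𝓡 · ·`; its junctions `coreOff_record_of_{collarPair,threeSector_collar,fourSector_collar}_at_26_5` end with
`.of_le_core` at the record core `24/5`, so they do NOT hand the RIM `(24/5, 1/100) → (26/5, 1/100)` to the `_rim_` consumers of record (`…HomFloorF6pT26` §1).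
This file reads the same cells ONE STEP EARLIER, most general first:

* §1 (table-generic) `tubeFloorGB_threeSector_stepPair` — (E∣𝔇)(B₁) ∧ (E∣𝔅)(B₂) ∧ (E∣𝔄) ⟹ (E) at `sectorPair (Dense dA) (stepPair 𝓡 B₁ B₂) (constTol (1/25))` for ANY
  two pair tables; ★★ `coreOff_26_5_of_threeSector_stepPair` / `rim_26_5_of_threeSector_stepPair` / `coreOff_record_of_threeSector_stepPair` — the three-sector
  junction at ANY dense-side table `stepPair 𝓡 B₁ B₂` (B-generic roots `coreOff_of_tubeFloorGB_of_coarse_of_refineGB`, `refineGB_threeSector`, `rim_of_coreOffTubeFloor`).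
* §2 (collar of record) `coreOff_26_5_of_threeSector_collar` / `rim_26_5_…` and the FOUR-SECTOR versions (band re-dialled at `dB`, node's `tubeFloorGB_band_of_two` /
  `refineGB_band_of_two`) — hypotheses VERBATIM those of the node's `coreOff_record_of_fourSector_collar_at_26_5`; CONTAINMENT `example`: that theorem is §2 `.of_le_core`.
* §3 (instrument glue, B-generic) `pairKernelCert_stepPair_of_pos/_of_neg` — a kernel-cut certificate on the hosts OF / OFF the class `𝓟` at its own table is one at
  the stepped table; `pairKernelCert_bandLo_collar_glued` / `_bandHi_`; ★★ `refineGB_ND_collar_of_kernelCut_top` ((N∣𝔇′)ᴸ: identity refit, (E κ) ∧ (P₀ κ) at the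
  COLLARED cone — what RLOC L2.9 instruments), `refineGB_NBlo_collar_of_kernelCut_top` ((N∣𝔅lo) at its own cone under the collared dense table).

* §4 (appended, g43) the FOUR-sector junction at THREE GENERIC TABLES `stepPair 𝓡 B₁ (stepPair (Dense dB) B₂ B₃)` at `26/5` + RIM + cap (`stepPair_three_le`); §2 ⊂ §4 (`example`).
* §5 (appended, g43) B-generic instrument glue at nested stepped tables (`pairKernelCert_bandLo/Hi_stepPair`, `refineGB_stepPair_of_kernelCut_top_pos/_neg`,
  `refineGB_bandLo/Hi_stepPair_of_kernelCut_top`) and ★★ `refineGB_ND_collar_of_taylor_top` ((N∣𝔇′)ᴸ from `forceCapOne` ∧ (TFR-G κσ₁) ∧ (P₀ κ) at the collared cone).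

One-line compositions of landed theorems; 0 sorry; no definitions; standard axioms.  `--supports stmt-AtomisticToContinuum-27623`.  [folklore instantiation]
-/

noncomputable section

open scoped BigOperators Classical RealInnerProductSpace
open Summit.AtomisticToContinuum.Crystallization.Theorems.ChargedEnergyGapNegative (eStar E3)
open Summit.AtomisticToContinuum.Crystallization.Theorems.FrustratedLawDichotomyRangeCut
open Summit.AtomisticToContinuum.Crystallization.Theorems.FrustratedLawDichotomyAveragingCut (ballAvg)
open Summit.AtomisticToContinuum.Crystallization.Theorems.FrustratedLawDichotomyStrainedPatchHomSplit
open Summit.AtomisticToContinuum.Crystallization.Theorems.FrustratedLawDichotomyStrainedPatchCoreTube (NearHomIsoAt CoreOffTubeFloor RimOffTubeFloor)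
open Summit.AtomisticToContinuum.Crystallization.Theorems.FrustratedLawDichotomyStrainedPatchChartFamilies (ChartBy FamilyLE familyLE_refl)
open Summit.AtomisticToContinuum.Crystallization.Theorems.FrustratedLawDichotomyStrainedPatchQuantSlaving
open Summit.AtomisticToContinuum.Crystallization.Theorems.FrustratedLawDichotomyStrainedPatchHostCells (TubeFloor FamP)
open Summit.AtomisticToContinuum.Crystallization.Theorems.FrustratedLawDichotomyStrainedPatchGradedTube
open Summit.AtomisticToContinuum.Crystallization.Theorems.FrustratedLawDichotomyStrainedPatchCoverBridge
open Summit.AtomisticToContinuum.Crystallization.Theorems.FrustratedLawDichotomyStrainedPatchPairTube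
open Summit.AtomisticToContinuum.Crystallization.Theorems.FrustratedLawDichotomyStrainedPatchKernelCut
open Summit.AtomisticToContinuum.Crystallization.Theorems.FrustratedLawDichotomyAperiodicGapRecordJunctionFallbackLever (rim_of_coreOffTubeFloor)
open Summit.AtomisticToContinuum.Crystallization.Theorems.FrustratedLawDichotomyStrainedPatchConeAnatomy
open Summit.AtomisticToContinuum.Crystallization.Theorems.FrustratedLawDichotomyStrainedPatchStiffSector
open Summit.AtomisticToContinuum.Crystallization.Theorems.FrustratedLawDichotomyStrainedPatchStiffDoor
open Summit.AtomisticToContinuum.Crystallization.Theorems.FrustratedLawDichotomyStrainedPatchKernelCutSector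
open Summit.AtomisticToContinuum.Crystallization.Theorems.FrustratedLawDichotomyStrainedPatchShearDoor
open Summit.AtomisticToContinuum.Crystallization.Theorems.FrustratedLawDichotomyStrainedPatchPairTubeCollar

namespace Summit.AtomisticToContinuum.Crystallization.Theorems.FrustratedLawDichotomyAperiodicGapRecordJunctionFourSectorCollar

/-! ## §1. The three-sector junction at a GENERIC dense-side table `stepPair 𝓡 B₁ B₂`, read at the `26/5` core -/

section Generic

variable {𝓘₀ 𝓗 𝓘 𝓡 : ChartFam} {dA : ℝ} {B₁ B₂ : PairTab}

/-- ★ (E) at the sector table from the three E-cells at ANY two dense tables: (E∣𝔇)(B₁) on `𝓡`-hosts, (E∣𝔅)(B₂) off them, (E∣𝔄) pair-blind on the dilated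
sector (`sectorPair_eq_stepPair`, `tubeFloorGB_stepPair` twice). [formal bookkeeping] -/
theorem tubeFloorGB_threeSector_stepPair (hED : TubeFloorGB (famAnd (famAnd 𝓘 (Dense dA)) 𝓡) (1 / 25) (constTol (1 / 25)) B₁)
    (hEB : TubeFloorGB (famAndNot (famAnd 𝓘 (Dense dA)) 𝓡) (1 / 25) (constTol (1 / 25)) B₂) (hEA : TubeFloor (famAndNot 𝓘 (Dense dA)) (1 / 25)) :
    TubeFloorGB 𝓘 (1 / 25) (constTol (1 / 25)) (sectorPair (Dense dA) (stepPair 𝓡 B₁ B₂) (constTol (1 / 25))) := by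
  rw [sectorPair_eq_stepPair]
  exact tubeFloorGB_stepPair (tubeFloorGB_stepPair hED hEB) (tubeFloorGB_pairSum_of_tubeFloor hEA)

/-- ★★ **[CORE-FAR] AT THE `26/5` CORE FROM THE THREE-SECTOR CELLS AT ANY DENSE-SIDE TABLE `stepPair 𝓡 B₁ B₂`**: (E∣𝔇)(B₁) ∧ (E∣𝔅)(B₂) ∧ (E∣𝔄) ∧ `𝓘₀`-cover ∧
(N∣𝔇) ∧ (N∣𝔅) (both at the stepped table) ∧ `famAndNot 𝓘₀ (Dense dA) ≤ 𝓗 ≤ 𝓘` ∧ cap ⟹ `CoreOffTubeFloor (63/10) (63/10) (26/5) (1/100) 0`.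
[formal bookkeeping: `coreOff_of_tubeFloorGB_of_coarse_of_refineGB` at `tubeFloorGB_threeSector_stepPair` / `refineGB_threeSector`] -/
theorem coreOff_26_5_of_threeSector_stepPair (hED : TubeFloorGB (famAnd (famAnd 𝓘 (Dense dA)) 𝓡) (1 / 25) (constTol (1 / 25)) B₁)
    (hEB : TubeFloorGB (famAndNot (famAnd 𝓘 (Dense dA)) 𝓡) (1 / 25) (constTol (1 / 25)) B₂) (hEA : TubeFloor (famAndNot 𝓘 (Dense dA)) (1 / 25))
    (hK : FamilyCoverGRecAt 𝓘₀ (26 / 5) (1 / 100))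
    (hND : RefineGB (famAnd (famAnd 𝓘₀ (Dense dA)) 𝓡) 𝓗 (26 / 5) (1 / 100) (1 / 8) (1 / 25) (constTol (1 / 25)) (1 / 25) (constTol (1 / 25)) (stepPair 𝓡 B₁ B₂))
    (hNB : RefineGB (famAndNot (famAnd 𝓘₀ (Dense dA)) 𝓡) 𝓗 (26 / 5) (1 / 100) (1 / 8) (1 / 25) (constTol (1 / 25)) (1 / 25) (constTol (1 / 25)) (stepPair 𝓡 B₁ B₂))
    (h𝓗 : FamilyLE (famAndNot 𝓘₀ (Dense dA)) 𝓗) (hcap : PairLE (stepPair 𝓡 B₁ B₂) (pairSum (constTol (1 / 25)))) (h𝓘 : FamilyLE 𝓗 𝓘) :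
    CoreOffTubeFloor (63 / 10) (63 / 10) (26 / 5) (1 / 100) 0 :=
  coreOff_of_tubeFloorGB_of_coarse_of_refineGB (tubeFloorGB_threeSector_stepPair hED hEB hEA) hK
    ((refineGB_threeSector hND hNB h𝓗 le_rfl (TolLE.refl _) hcap).mono h𝓘 (TolLE.refl _) (PairLE.refl _) le_rfl)

/-- ★★ **RIM `(24/5, 1/100) → (26/5, 1/100)` FROM THE THREE-SECTOR CELLS AT ANY DENSE-SIDE TABLE** (`rim_of_coreOffTubeFloor`). [formal bookkeeping] -/
theorem rim_26_5_of_threeSector_stepPair (hED : TubeFloorGB (famAnd (famAnd 𝓘 (Dense dA)) 𝓡) (1 / 25) (constTol (1 / 25)) B₁)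
    (hEB : TubeFloorGB (famAndNot (famAnd 𝓘 (Dense dA)) 𝓡) (1 / 25) (constTol (1 / 25)) B₂) (hEA : TubeFloor (famAndNot 𝓘 (Dense dA)) (1 / 25))
    (hK : FamilyCoverGRecAt 𝓘₀ (26 / 5) (1 / 100))
    (hND : RefineGB (famAnd (famAnd 𝓘₀ (Dense dA)) 𝓡) 𝓗 (26 / 5) (1 / 100) (1 / 8) (1 / 25) (constTol (1 / 25)) (1 / 25) (constTol (1 / 25)) (stepPair 𝓡 B₁ B₂))
    (hNB : RefineGB (famAndNot (famAnd 𝓘₀ (Dense dA)) 𝓡) 𝓗 (26 / 5) (1 / 100) (1 / 8) (1 / 25) (constTol (1 / 25)) (1 / 25) (constTol (1 / 25)) (stepPair 𝓡 B₁ B₂))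
    (h𝓗 : FamilyLE (famAndNot 𝓘₀ (Dense dA)) 𝓗) (hcap : PairLE (stepPair 𝓡 B₁ B₂) (pairSum (constTol (1 / 25)))) (h𝓘 : FamilyLE 𝓗 𝓘) :
    RimOffTubeFloor (63 / 10) (63 / 10) (24 / 5) (1 / 100) (26 / 5) (1 / 100) 0 :=
  rim_of_coreOffTubeFloor (by norm_num) (coreOff_26_5_of_threeSector_stepPair hED hEB hEA hK hND hNB h𝓗 hcap h𝓘)

/-- … and the record [CORE-FAR] at `24/5` (`CoreOffTubeFloor.of_le_core`). [formal bookkeeping] -/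
theorem coreOff_record_of_threeSector_stepPair (hED : TubeFloorGB (famAnd (famAnd 𝓘 (Dense dA)) 𝓡) (1 / 25) (constTol (1 / 25)) B₁)
    (hEB : TubeFloorGB (famAndNot (famAnd 𝓘 (Dense dA)) 𝓡) (1 / 25) (constTol (1 / 25)) B₂) (hEA : TubeFloor (famAndNot 𝓘 (Dense dA)) (1 / 25))
    (hK : FamilyCoverGRecAt 𝓘₀ (26 / 5) (1 / 100))
    (hND : RefineGB (famAnd (famAnd 𝓘₀ (Dense dA)) 𝓡) 𝓗 (26 / 5) (1 / 100) (1 / 8) (1 / 25) (constTol (1 / 25)) (1 / 25) (constTol (1 / 25)) (stepPair 𝓡 B₁ B₂))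
    (hNB : RefineGB (famAndNot (famAnd 𝓘₀ (Dense dA)) 𝓡) 𝓗 (26 / 5) (1 / 100) (1 / 8) (1 / 25) (constTol (1 / 25)) (1 / 25) (constTol (1 / 25)) (stepPair 𝓡 B₁ B₂))
    (h𝓗 : FamilyLE (famAndNot 𝓘₀ (Dense dA)) 𝓗) (hcap : PairLE (stepPair 𝓡 B₁ B₂) (pairSum (constTol (1 / 25)))) (h𝓘 : FamilyLE 𝓗 𝓘) :
    CoreOffTubeFloor (63 / 10) (63 / 10) (24 / 5) (1 / 100) 0 :=
  (coreOff_26_5_of_threeSector_stepPair hED hEB hEA hK hND hNB h𝓗 hcap h𝓘).of_le_core (by norm_num)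

/-- CONSISTENCY: the RECORD three-sector table `relConeBy 2 (stepByF 𝓡 βf₁ βf₂) (stepByF 𝓡 sf₁ sf₂) (1/25)` of #32 is the stepped table of the two record cones
(node's `relConeBy_stepByF`), so §1 contains the record junction. [formal bookkeeping] -/
example (𝓡 : ChartFam) (βf₁ βf₂ sf₁ sf₂ : (M₀ : ℕ) → (Fin M₀ → E3) → Fin M₀ → ℝ) :
    relConeBy 2 (stepByF 𝓡 βf₁ βf₂) (stepByF 𝓡 sf₁ sf₂) (1 / 25) = stepPair 𝓡 (relConeBy 2 βf₁ sf₁ (1 / 25)) (relConeBy 2 βf₂ sf₂ (1 / 25)) :=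
  relConeBy_stepByF 𝓡 2 (1 / 25) βf₁ βf₂ sf₁ sf₂

end Generic

/-! ## §2. The collar of record on 𝔇′: three and four sectors at the `26/5` core, the RIM, containment of the node's junction -/

section Collar

variable {𝓘₀ 𝓗 𝓘 𝓡 : ChartFam} {dA dB ℓc : ℝ} {βf₁ βf₂ βf₃ sf₁ sf₂ sf₃ : (M₀ : ℕ) → (Fin M₀ → E3) → Fin M₀ → ℝ}

/-- ★★ **[CORE-FAR] AT `26/5` FROM THE THREE-SECTOR CELLS WITH THE COLLAR ON 𝔇′** (hypotheses verbatim those of the node's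
`coreOff_record_of_threeSector_collar_at_26_5`; = §1 at `B₁ := relConeLenBy 2 ℓc βf₁ sf₁ (1/25)`, `B₂ := relConeBy 2 βf₂ sf₂ (1/25)`). [formal bookkeeping] -/
theorem coreOff_26_5_of_threeSector_collar
    (hED : TubeFloorGBLenBy (famAnd (famAnd 𝓘 (Dense dA)) 𝓡) ℓc βf₁ sf₁)
    (hEB : TubeFloorGB (famAndNot (famAnd 𝓘 (Dense dA)) 𝓡) (1 / 25) (constTol (1 / 25)) (relConeBy 2 βf₂ sf₂ (1 / 25)))
    (hEA : TubeFloor (famAndNot 𝓘 (Dense dA)) (1 / 25))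
    (hK : FamilyCoverGRecAt 𝓘₀ (26 / 5) (1 / 100))
    (hND : RefineGB (famAnd (famAnd 𝓘₀ (Dense dA)) 𝓡) 𝓗 (26 / 5) (1 / 100) (1 / 8) (1 / 25) (constTol (1 / 25)) (1 / 25) (constTol (1 / 25))
      (stepPair 𝓡 (relConeLenBy 2 ℓc βf₁ sf₁ (1 / 25)) (relConeBy 2 βf₂ sf₂ (1 / 25))))
    (hNB : RefineGB (famAndNot (famAnd 𝓘₀ (Dense dA)) 𝓡) 𝓗 (26 / 5) (1 / 100) (1 / 8) (1 / 25) (constTol (1 / 25)) (1 / 25) (constTol (1 / 25))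
      (stepPair 𝓡 (relConeLenBy 2 ℓc βf₁ sf₁ (1 / 25)) (relConeBy 2 βf₂ sf₂ (1 / 25))))
    (h𝓗 : FamilyLE (famAndNot 𝓘₀ (Dense dA)) 𝓗)
    (hcap : PairLE (stepPair 𝓡 (relConeLenBy 2 ℓc βf₁ sf₁ (1 / 25)) (relConeBy 2 βf₂ sf₂ (1 / 25))) (pairSum (constTol (1 / 25))))
    (h𝓘 : FamilyLE 𝓗 𝓘) : CoreOffTubeFloor (63 / 10) (63 / 10) (26 / 5) (1 / 100) 0 :=
  coreOff_26_5_of_threeSector_stepPair hED hEB hEA hK hND hNB h𝓗 hcap h𝓘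

/-- ★★ **[CORE-FAR] AT `26/5` FROM THE FOUR-SECTOR CELLS WITH THE COLLAR ON 𝔇′** (band re-dialled at `dB`; hypotheses verbatim those of the node's
`coreOff_record_of_fourSector_collar_at_26_5`). [formal bookkeeping: §2 three-sector at `tubeFloorGB_band_of_two` / `refineGB_band_of_two`] -/
theorem coreOff_26_5_of_fourSector_collar
    (hED : TubeFloorGBLenBy (famAnd (famAnd 𝓘 (Dense dA)) 𝓡) ℓc βf₁ sf₁)
    (hEBlo : TubeFloorGB (famAnd (famAndNot (famAnd 𝓘 (Dense dA)) 𝓡) (Dense dB)) (1 / 25) (constTol (1 / 25)) (relConeBy 2 βf₂ sf₂ (1 / 25)))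
    (hEBhi : TubeFloorGB (famAndNot (famAndNot (famAnd 𝓘 (Dense dA)) 𝓡) (Dense dB)) (1 / 25) (constTol (1 / 25)) (relConeBy 2 βf₃ sf₃ (1 / 25)))
    (hEA : TubeFloor (famAndNot 𝓘 (Dense dA)) (1 / 25))
    (hK : FamilyCoverGRecAt 𝓘₀ (26 / 5) (1 / 100))
    (hND : RefineGB (famAnd (famAnd 𝓘₀ (Dense dA)) 𝓡) 𝓗 (26 / 5) (1 / 100) (1 / 8) (1 / 25) (constTol (1 / 25)) (1 / 25) (constTol (1 / 25))
      (stepPair 𝓡 (relConeLenBy 2 ℓc βf₁ sf₁ (1 / 25)) (relConeBy 2 (stepByF (Dense dB) βf₂ βf₃) (stepByF (Dense dB) sf₂ sf₃) (1 / 25))))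
    (hNBlo : RefineGB (famAnd (famAndNot (famAnd 𝓘₀ (Dense dA)) 𝓡) (Dense dB)) 𝓗 (26 / 5) (1 / 100) (1 / 8) (1 / 25) (constTol (1 / 25)) (1 / 25)
      (constTol (1 / 25)) (stepPair 𝓡 (relConeLenBy 2 ℓc βf₁ sf₁ (1 / 25)) (relConeBy 2 (stepByF (Dense dB) βf₂ βf₃) (stepByF (Dense dB) sf₂ sf₃) (1 / 25))))
    (hNBhi : RefineGB (famAndNot (famAndNot (famAnd 𝓘₀ (Dense dA)) 𝓡) (Dense dB)) 𝓗 (26 / 5) (1 / 100) (1 / 8) (1 / 25) (constTol (1 / 25)) (1 / 25)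
      (constTol (1 / 25)) (stepPair 𝓡 (relConeLenBy 2 ℓc βf₁ sf₁ (1 / 25)) (relConeBy 2 (stepByF (Dense dB) βf₂ βf₃) (stepByF (Dense dB) sf₂ sf₃) (1 / 25))))
    (h𝓗 : FamilyLE (famAndNot 𝓘₀ (Dense dA)) 𝓗)
    (hcap : PairLE (stepPair 𝓡 (relConeLenBy 2 ℓc βf₁ sf₁ (1 / 25)) (relConeBy 2 (stepByF (Dense dB) βf₂ βf₃) (stepByF (Dense dB) sf₂ sf₃) (1 / 25)))
      (pairSum (constTol (1 / 25))))
    (h𝓘 : FamilyLE 𝓗 𝓘) : CoreOffTubeFloor (63 / 10) (63 / 10) (26 / 5) (1 / 100) 0 :=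
  coreOff_26_5_of_threeSector_collar hED (tubeFloorGB_band_of_two hEBlo hEBhi) hEA hK hND (refineGB_band_of_two hNBlo hNBhi) h𝓗 hcap h𝓘

/-- ★★ **RIM `(24/5, 1/100) → (26/5, 1/100)` FROM THE FOUR-SECTOR CELLS WITH THE COLLAR ON 𝔇′** — what every `_rim_` consumer of record takes from the
collared cut. [formal bookkeeping: `rim_of_coreOffTubeFloor`] -/
theorem rim_26_5_of_fourSector_collar
    (hED : TubeFloorGBLenBy (famAnd (famAnd 𝓘 (Dense dA)) 𝓡) ℓc βf₁ sf₁)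
    (hEBlo : TubeFloorGB (famAnd (famAndNot (famAnd 𝓘 (Dense dA)) 𝓡) (Dense dB)) (1 / 25) (constTol (1 / 25)) (relConeBy 2 βf₂ sf₂ (1 / 25)))
    (hEBhi : TubeFloorGB (famAndNot (famAndNot (famAnd 𝓘 (Dense dA)) 𝓡) (Dense dB)) (1 / 25) (constTol (1 / 25)) (relConeBy 2 βf₃ sf₃ (1 / 25)))
    (hEA : TubeFloor (famAndNot 𝓘 (Dense dA)) (1 / 25))
    (hK : FamilyCoverGRecAt 𝓘₀ (26 / 5) (1 / 100))
    (hND : RefineGB (famAnd (famAnd 𝓘₀ (Dense dA)) 𝓡) 𝓗 (26 / 5) (1 / 100) (1 / 8) (1 / 25) (constTol (1 / 25)) (1 / 25) (constTol (1 / 25))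
      (stepPair 𝓡 (relConeLenBy 2 ℓc βf₁ sf₁ (1 / 25)) (relConeBy 2 (stepByF (Dense dB) βf₂ βf₃) (stepByF (Dense dB) sf₂ sf₃) (1 / 25))))
    (hNBlo : RefineGB (famAnd (famAndNot (famAnd 𝓘₀ (Dense dA)) 𝓡) (Dense dB)) 𝓗 (26 / 5) (1 / 100) (1 / 8) (1 / 25) (constTol (1 / 25)) (1 / 25)
      (constTol (1 / 25)) (stepPair 𝓡 (relConeLenBy 2 ℓc βf₁ sf₁ (1 / 25)) (relConeBy 2 (stepByF (Dense dB) βf₂ βf₃) (stepByF (Dense dB) sf₂ sf₃) (1 / 25))))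
    (hNBhi : RefineGB (famAndNot (famAndNot (famAnd 𝓘₀ (Dense dA)) 𝓡) (Dense dB)) 𝓗 (26 / 5) (1 / 100) (1 / 8) (1 / 25) (constTol (1 / 25)) (1 / 25)
      (constTol (1 / 25)) (stepPair 𝓡 (relConeLenBy 2 ℓc βf₁ sf₁ (1 / 25)) (relConeBy 2 (stepByF (Dense dB) βf₂ βf₃) (stepByF (Dense dB) sf₂ sf₃) (1 / 25))))
    (h𝓗 : FamilyLE (famAndNot 𝓘₀ (Dense dA)) 𝓗)
    (hcap : PairLE (stepPair 𝓡 (relConeLenBy 2 ℓc βf₁ sf₁ (1 / 25)) (relConeBy 2 (stepByF (Dense dB) βf₂ βf₃) (stepByF (Dense dB) sf₂ sf₃) (1 / 25)))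
      (pairSum (constTol (1 / 25))))
    (h𝓘 : FamilyLE 𝓗 𝓘) : RimOffTubeFloor (63 / 10) (63 / 10) (24 / 5) (1 / 100) (26 / 5) (1 / 100) 0 :=
  rim_of_coreOffTubeFloor (by norm_num) (coreOff_26_5_of_fourSector_collar hED hEBlo hEBhi hEA hK hND hNBlo hNBhi h𝓗 hcap h𝓘)

/-- CONTAINMENT (NODE 100b §5): the node's `coreOff_record_of_fourSector_collar_at_26_5` is §2 `.of_le_core` — hypotheses copied verbatim. [formal bookkeeping] -/
example
    (hED : TubeFloorGBLenBy (famAnd (famAnd 𝓘 (Dense dA)) 𝓡) ℓc βf₁ sf₁)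
    (hEBlo : TubeFloorGB (famAnd (famAndNot (famAnd 𝓘 (Dense dA)) 𝓡) (Dense dB)) (1 / 25) (constTol (1 / 25)) (relConeBy 2 βf₂ sf₂ (1 / 25)))
    (hEBhi : TubeFloorGB (famAndNot (famAndNot (famAnd 𝓘 (Dense dA)) 𝓡) (Dense dB)) (1 / 25) (constTol (1 / 25)) (relConeBy 2 βf₃ sf₃ (1 / 25)))
    (hEA : TubeFloor (famAndNot 𝓘 (Dense dA)) (1 / 25))
    (hK : FamilyCoverGRecAt 𝓘₀ (26 / 5) (1 / 100))
    (hND : RefineGB (famAnd (famAnd 𝓘₀ (Dense dA)) 𝓡) 𝓗 (26 / 5) (1 / 100) (1 / 8) (1 / 25) (constTol (1 / 25)) (1 / 25) (constTol (1 / 25))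
      (stepPair 𝓡 (relConeLenBy 2 ℓc βf₁ sf₁ (1 / 25)) (relConeBy 2 (stepByF (Dense dB) βf₂ βf₃) (stepByF (Dense dB) sf₂ sf₃) (1 / 25))))
    (hNBlo : RefineGB (famAnd (famAndNot (famAnd 𝓘₀ (Dense dA)) 𝓡) (Dense dB)) 𝓗 (26 / 5) (1 / 100) (1 / 8) (1 / 25) (constTol (1 / 25)) (1 / 25)
      (constTol (1 / 25)) (stepPair 𝓡 (relConeLenBy 2 ℓc βf₁ sf₁ (1 / 25)) (relConeBy 2 (stepByF (Dense dB) βf₂ βf₃) (stepByF (Dense dB) sf₂ sf₃) (1 / 25))))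
    (hNBhi : RefineGB (famAndNot (famAndNot (famAnd 𝓘₀ (Dense dA)) 𝓡) (Dense dB)) 𝓗 (26 / 5) (1 / 100) (1 / 8) (1 / 25) (constTol (1 / 25)) (1 / 25)
      (constTol (1 / 25)) (stepPair 𝓡 (relConeLenBy 2 ℓc βf₁ sf₁ (1 / 25)) (relConeBy 2 (stepByF (Dense dB) βf₂ βf₃) (stepByF (Dense dB) sf₂ sf₃) (1 / 25))))
    (h𝓗 : FamilyLE (famAndNot 𝓘₀ (Dense dA)) 𝓗)
    (hcap : PairLE (stepPair 𝓡 (relConeLenBy 2 ℓc βf₁ sf₁ (1 / 25)) (relConeBy 2 (stepByF (Dense dB) βf₂ βf₃) (stepByF (Dense dB) sf₂ sf₃) (1 / 25)))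
      (pairSum (constTol (1 / 25))))
    (h𝓘 : FamilyLE 𝓗 𝓘) : CoreOffTubeFloor (63 / 10) (63 / 10) (24 / 5) (1 / 100) 0 :=
  (coreOff_26_5_of_fourSector_collar hED hEBlo hEBhi hEA hK hND hNBlo hNBhi h𝓗 hcap h𝓘).of_le_core (by norm_num)

end Collar

/-! ## §3. Kernel-cut instrument glue for stepped tables; the collar N-cells in the INSTRUMENTED form -/

section Glue

variable {𝓙 𝓟 : ChartFam} {𝓑 : BalPred} {τ₁ τ κ σ : ℝ} {T₁ T : SlackTab} {H : HessTab} {F : ForceTab} {X : SlackTab} {B₁ B₂ : PairTab}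

/-- ★ A kernel-cut certificate on the hosts OF the class `𝓟` at table `B₁` is one at the stepped table `stepPair 𝓟 B₁ B₂` (`stepPair_of_pos`; B-generic
form of `…KernelCutSector.pairKernelCert_stepByF_of_pos`). [formal bookkeeping] -/
theorem pairKernelCert_stepPair_of_pos (h : PairKernelCert (famAnd 𝓙 𝓟) 𝓑 τ₁ T₁ κ σ H F X τ T B₁) :
    PairKernelCert (famAnd 𝓙 𝓟) 𝓑 τ₁ T₁ κ σ H F X τ T (stepPair 𝓟 B₁ B₂) :=
  pairKernelCert_congr_pair (fun _ _ _ hm a b => (stepPair_of_pos hm.2 a b).symm) h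

/-- … and one on the hosts OFF the class at `B₂` is one at the stepped table (`stepPair_of_neg`). [formal bookkeeping] -/
theorem pairKernelCert_stepPair_of_neg (h : PairKernelCert (famAndNot 𝓙 𝓟) 𝓑 τ₁ T₁ κ σ H F X τ T B₂) :
    PairKernelCert (famAndNot 𝓙 𝓟) 𝓑 τ₁ T₁ κ σ H F X τ T (stepPair 𝓟 B₁ B₂) :=
  pairKernelCert_congr_pair (fun _ _ _ hm a b => (stepPair_of_neg hm.2 a b).symm) h

end Glue

section CollarCells

variable {𝓘₀ 𝓗 𝓡 : ChartFam} {𝓑 : BalPred} {dA dB ℓc RE τ₀ τ₁ τ κ σ : ℝ} {T₁ T : SlackTab} {H : HessTab} {F : ForceTab} {X : SlackTab} {B₁ B₂ : PairTab}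
  {βf₁ βf₂ βf₃ sf₁ sf₂ sf₃ : (M₀ : ℕ) → (Fin M₀ → E3) → Fin M₀ → ℝ}

/-- ★ On 𝔅lo hosts (`¬𝓡`, `Dense dB`) the collared dense-side table `stepPair 𝓡 B₁ (relConeBy RE (stepByF (Dense dB) βf₂ βf₃) (stepByF (Dense dB) sf₂ sf₃) τ₀)` IS the
low-band cone `(βf₂, sf₂)`: the instrument run on 𝔅lo at its own cone certifies the cell at the collared table. [formal bookkeeping] -/
theorem pairKernelCert_bandLo_collar_glued
    (h : PairKernelCert (famAnd (famAndNot (famAnd 𝓘₀ (Dense dA)) 𝓡) (Dense dB)) 𝓑 τ₁ T₁ κ σ H F X τ T (relConeBy RE βf₂ sf₂ τ₀)) :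
    PairKernelCert (famAnd (famAndNot (famAnd 𝓘₀ (Dense dA)) 𝓡) (Dense dB)) 𝓑 τ₁ T₁ κ σ H F X τ T
      (stepPair 𝓡 B₁ (relConeBy RE (stepByF (Dense dB) βf₂ βf₃) (stepByF (Dense dB) sf₂ sf₃) τ₀)) := by
  refine pairKernelCert_congr_pair (fun M₀ z₀ c₀ hm a b => ?_) h
  rw [stepPair_of_neg hm.1.2]
  simp only [relConeBy, stepByF_of_pos hm.2]

/-- … and on 𝔅hi hosts (`¬𝓡`, `¬Dense dB`) it IS the high-band cone `(βf₃, sf₃)`. [formal bookkeeping] -/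
theorem pairKernelCert_bandHi_collar_glued
    (h : PairKernelCert (famAndNot (famAndNot (famAnd 𝓘₀ (Dense dA)) 𝓡) (Dense dB)) 𝓑 τ₁ T₁ κ σ H F X τ T (relConeBy RE βf₃ sf₃ τ₀)) :
    PairKernelCert (famAndNot (famAndNot (famAnd 𝓘₀ (Dense dA)) 𝓡) (Dense dB)) 𝓑 τ₁ T₁ κ σ H F X τ T
      (stepPair 𝓡 B₁ (relConeBy RE (stepByF (Dense dB) βf₂ βf₃) (stepByF (Dense dB) sf₂ sf₃) τ₀)) := by
  refine pairKernelCert_congr_pair (fun M₀ z₀ c₀ hm a b => ?_) h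
  rw [stepPair_of_neg hm.1.2]
  simp only [relConeBy, stepByF_of_neg hm.2]

/-- ★★ **(N∣𝔇′)ᴸ — THE INSTRUMENTED FORM AT THE COLLARED CONE**: identity refit, (E κ) ∧ (P₀ κ) on the door family `famAnd (famAnd 𝓘₀ (Dense dA)) 𝓡` with the
certificate at `relConeLenBy 2 ℓc βf₁ sf₁ (1/25)` (the cone only on pairs of length `≤ ℓc`), hull `𝓗 ⊇` the family, ANY off-door table `B₂` — what RLOC L2.9
(census queue, critic row 1617 (4)) instruments. [folklore instantiation: `refineGB_of_kernelCut_top` at `pairKernelCert_stepPair_of_pos`] -/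
theorem refineGB_ND_collar_of_kernelCut_top (h𝓗 : FamilyLE (famAnd (famAnd 𝓘₀ (Dense dA)) 𝓡) 𝓗)
    (hE : SlavingEnclosureG (famAnd (famAnd 𝓘₀ (Dense dA)) 𝓡) balTop (26 / 5) (1 / 100) (1 / 8) (1 / 25) (constTol (1 / 25)) κ σ H F X)
    (hP : PairKernelCert (famAnd (famAnd 𝓘₀ (Dense dA)) 𝓡) balTop (1 / 25) (constTol (1 / 25)) κ σ H F X (1 / 25) (constTol (1 / 25))
      (relConeLenBy 2 ℓc βf₁ sf₁ (1 / 25))) :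
    RefineGB (famAnd (famAnd 𝓘₀ (Dense dA)) 𝓡) 𝓗 (26 / 5) (1 / 100) (1 / 8) (1 / 25) (constTol (1 / 25)) (1 / 25) (constTol (1 / 25))
      (stepPair 𝓡 (relConeLenBy 2 ℓc βf₁ sf₁ (1 / 25)) B₂) :=
  refineGB_of_kernelCut_top h𝓗 hE (pairKernelCert_stepPair_of_pos hP)

/-- ★★ **(N∣𝔅lo) UNDER THE COLLARED DENSE TABLE — INSTRUMENTED FORM**: identity refit, (E κ′) ∧ (P₀ κ′) on the low-band family at ITS cone `(βf₂, sf₂)`,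
hull `𝓗 ⊇` the family, ANY door table `B₁`. [folklore instantiation: `refineGB_of_kernelCut_top` at `pairKernelCert_bandLo_collar_glued`] -/
theorem refineGB_NBlo_collar_of_kernelCut_top (h𝓗 : FamilyLE (famAnd (famAndNot (famAnd 𝓘₀ (Dense dA)) 𝓡) (Dense dB)) 𝓗)
    (hE : SlavingEnclosureG (famAnd (famAndNot (famAnd 𝓘₀ (Dense dA)) 𝓡) (Dense dB)) balTop (26 / 5) (1 / 100) (1 / 8) (1 / 25) (constTol (1 / 25))
      κ σ H F X)
    (hP : PairKernelCert (famAnd (famAndNot (famAnd 𝓘₀ (Dense dA)) 𝓡) (Dense dB)) balTop (1 / 25) (constTol (1 / 25)) κ σ H F X (1 / 25)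
      (constTol (1 / 25)) (relConeBy 2 βf₂ sf₂ (1 / 25))) :
    RefineGB (famAnd (famAndNot (famAnd 𝓘₀ (Dense dA)) 𝓡) (Dense dB)) 𝓗 (26 / 5) (1 / 100) (1 / 8) (1 / 25) (constTol (1 / 25)) (1 / 25)
      (constTol (1 / 25)) (stepPair 𝓡 B₁ (relConeBy 2 (stepByF (Dense dB) βf₂ βf₃) (stepByF (Dense dB) sf₂ sf₃) (1 / 25))) :=
  refineGB_of_kernelCut_top h𝓗 hE (pairKernelCert_bandLo_collar_glued hP)

/-- ★ (N∣𝔅hi) under the collared dense table from a certificate at the wide cone `(βf₃, sf₃)` (same shape; its instrument is UNDECIDED — BAND-95-CERT).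
[folklore instantiation] -/
theorem refineGB_NBhi_collar_of_kernelCut_top (h𝓗 : FamilyLE (famAndNot (famAndNot (famAnd 𝓘₀ (Dense dA)) 𝓡) (Dense dB)) 𝓗)
    (hE : SlavingEnclosureG (famAndNot (famAndNot (famAnd 𝓘₀ (Dense dA)) 𝓡) (Dense dB)) balTop (26 / 5) (1 / 100) (1 / 8) (1 / 25) (constTol (1 / 25))
      κ σ H F X)
    (hP : PairKernelCert (famAndNot (famAndNot (famAnd 𝓘₀ (Dense dA)) 𝓡) (Dense dB)) balTop (1 / 25) (constTol (1 / 25)) κ σ H F X (1 / 25)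
      (constTol (1 / 25)) (relConeBy 2 βf₃ sf₃ (1 / 25))) :
    RefineGB (famAndNot (famAndNot (famAnd 𝓘₀ (Dense dA)) 𝓡) (Dense dB)) 𝓗 (26 / 5) (1 / 100) (1 / 8) (1 / 25) (constTol (1 / 25)) (1 / 25)
      (constTol (1 / 25)) (stepPair 𝓡 B₁ (relConeBy 2 (stepByF (Dense dB) βf₂ βf₃) (stepByF (Dense dB) sf₂ sf₃) (1 / 25))) :=
  refineGB_of_kernelCut_top h𝓗 hE (pairKernelCert_bandHi_collar_glued hP)

end CollarCells

/-! ## §4. The FOUR-sector junction at THREE GENERIC TABLES `B₁` (door), `B₂` (low band), `B₃` (high band) — dense-side table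
`stepPair 𝓡 B₁ (stepPair (Dense dB) B₂ B₃)` — read at the `26/5` core (appended, hand-2 g43; every later re-dial of a sector's table is one line here) -/

section FourGeneric

variable {𝓘₀ 𝓗 𝓘 𝓡 : ChartFam} {dA dB : ℝ} {B B₁ B₂ B₃ : PairTab}

/-- ★★ **[CORE-FAR] AT `26/5` FROM THE FOUR-SECTOR CELLS AT ANY THREE TABLES**: (E∣𝔇)(B₁) ∧ (E∣𝔅lo)(B₂) ∧ (E∣𝔅hi)(B₃) ∧ (E∣𝔄) ∧ `𝓘₀`-cover ∧ (N∣𝔇) ∧ (N∣𝔅lo) ∧ (N∣𝔅hi)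
(all at the nested stepped table) ∧ `famAndNot 𝓘₀ (Dense dA) ≤ 𝓗 ≤ 𝓘` ∧ cap ⟹ `CoreOffTubeFloor (63/10) (63/10) (26/5) (1/100) 0`.
[formal bookkeeping: §1 at the node's B-generic glue `tubeFloorGB_stepPair` (band) / `refineGB_band_of_two`] -/
theorem coreOff_26_5_of_fourSector_stepPair
    (hED : TubeFloorGB (famAnd (famAnd 𝓘 (Dense dA)) 𝓡) (1 / 25) (constTol (1 / 25)) B₁)
    (hEBlo : TubeFloorGB (famAnd (famAndNot (famAnd 𝓘 (Dense dA)) 𝓡) (Dense dB)) (1 / 25) (constTol (1 / 25)) B₂)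
    (hEBhi : TubeFloorGB (famAndNot (famAndNot (famAnd 𝓘 (Dense dA)) 𝓡) (Dense dB)) (1 / 25) (constTol (1 / 25)) B₃)
    (hEA : TubeFloor (famAndNot 𝓘 (Dense dA)) (1 / 25)) (hK : FamilyCoverGRecAt 𝓘₀ (26 / 5) (1 / 100))
    (hND : RefineGB (famAnd (famAnd 𝓘₀ (Dense dA)) 𝓡) 𝓗 (26 / 5) (1 / 100) (1 / 8) (1 / 25) (constTol (1 / 25)) (1 / 25) (constTol (1 / 25))
      (stepPair 𝓡 B₁ (stepPair (Dense dB) B₂ B₃)))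
    (hNBlo : RefineGB (famAnd (famAndNot (famAnd 𝓘₀ (Dense dA)) 𝓡) (Dense dB)) 𝓗 (26 / 5) (1 / 100) (1 / 8) (1 / 25) (constTol (1 / 25)) (1 / 25)
      (constTol (1 / 25)) (stepPair 𝓡 B₁ (stepPair (Dense dB) B₂ B₃)))
    (hNBhi : RefineGB (famAndNot (famAndNot (famAnd 𝓘₀ (Dense dA)) 𝓡) (Dense dB)) 𝓗 (26 / 5) (1 / 100) (1 / 8) (1 / 25) (constTol (1 / 25)) (1 / 25)
      (constTol (1 / 25)) (stepPair 𝓡 B₁ (stepPair (Dense dB) B₂ B₃)))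
    (h𝓗 : FamilyLE (famAndNot 𝓘₀ (Dense dA)) 𝓗) (hcap : PairLE (stepPair 𝓡 B₁ (stepPair (Dense dB) B₂ B₃)) (pairSum (constTol (1 / 25)))) (h𝓘 : FamilyLE 𝓗 𝓘) :
    CoreOffTubeFloor (63 / 10) (63 / 10) (26 / 5) (1 / 100) 0 :=
  coreOff_26_5_of_threeSector_stepPair hED (tubeFloorGB_stepPair hEBlo hEBhi) hEA hK hND (refineGB_band_of_two hNBlo hNBhi) h𝓗 hcap h𝓘

/-- ★★ **RIM `(24/5, 1/100) → (26/5, 1/100)` FROM THE FOUR-SECTOR CELLS AT ANY THREE TABLES.** [formal bookkeeping: `rim_of_coreOffTubeFloor`] -/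
theorem rim_26_5_of_fourSector_stepPair
    (hED : TubeFloorGB (famAnd (famAnd 𝓘 (Dense dA)) 𝓡) (1 / 25) (constTol (1 / 25)) B₁)
    (hEBlo : TubeFloorGB (famAnd (famAndNot (famAnd 𝓘 (Dense dA)) 𝓡) (Dense dB)) (1 / 25) (constTol (1 / 25)) B₂)
    (hEBhi : TubeFloorGB (famAndNot (famAndNot (famAnd 𝓘 (Dense dA)) 𝓡) (Dense dB)) (1 / 25) (constTol (1 / 25)) B₃)
    (hEA : TubeFloor (famAndNot 𝓘 (Dense dA)) (1 / 25)) (hK : FamilyCoverGRecAt 𝓘₀ (26 / 5) (1 / 100))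
    (hND : RefineGB (famAnd (famAnd 𝓘₀ (Dense dA)) 𝓡) 𝓗 (26 / 5) (1 / 100) (1 / 8) (1 / 25) (constTol (1 / 25)) (1 / 25) (constTol (1 / 25))
      (stepPair 𝓡 B₁ (stepPair (Dense dB) B₂ B₃)))
    (hNBlo : RefineGB (famAnd (famAndNot (famAnd 𝓘₀ (Dense dA)) 𝓡) (Dense dB)) 𝓗 (26 / 5) (1 / 100) (1 / 8) (1 / 25) (constTol (1 / 25)) (1 / 25)
      (constTol (1 / 25)) (stepPair 𝓡 B₁ (stepPair (Dense dB) B₂ B₃)))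
    (hNBhi : RefineGB (famAndNot (famAndNot (famAnd 𝓘₀ (Dense dA)) 𝓡) (Dense dB)) 𝓗 (26 / 5) (1 / 100) (1 / 8) (1 / 25) (constTol (1 / 25)) (1 / 25)
      (constTol (1 / 25)) (stepPair 𝓡 B₁ (stepPair (Dense dB) B₂ B₃)))
    (h𝓗 : FamilyLE (famAndNot 𝓘₀ (Dense dA)) 𝓗) (hcap : PairLE (stepPair 𝓡 B₁ (stepPair (Dense dB) B₂ B₃)) (pairSum (constTol (1 / 25)))) (h𝓘 : FamilyLE 𝓗 𝓘) :
    RimOffTubeFloor (63 / 10) (63 / 10) (24 / 5) (1 / 100) (26 / 5) (1 / 100) 0 :=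
  rim_of_coreOffTubeFloor (by norm_num) (coreOff_26_5_of_fourSector_stepPair hED hEBlo hEBhi hEA hK hND hNBlo hNBhi h𝓗 hcap h𝓘)

/-- The nested table is capped when its three pieces are (`stepPair_le` twice). [formal bookkeeping] -/
theorem stepPair_three_le (h₁ : PairLE B₁ B) (h₂ : PairLE B₂ B) (h₃ : PairLE B₃ B) : PairLE (stepPair 𝓡 B₁ (stepPair (Dense dB) B₂ B₃)) B :=
  stepPair_le h₁ (stepPair_le h₂ h₃)

/-- CONSISTENCY: the collared four-sector dense table of §2 IS the nested step of its three cones (node's `relConeBy_stepByF`), so §2 ⊂ §4. [formal bookkeeping] -/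
example (ℓc : ℝ) (βf₁ βf₂ βf₃ sf₁ sf₂ sf₃ : (M₀ : ℕ) → (Fin M₀ → E3) → Fin M₀ → ℝ) :
    stepPair 𝓡 (relConeLenBy 2 ℓc βf₁ sf₁ (1 / 25)) (relConeBy 2 (stepByF (Dense dB) βf₂ βf₃) (stepByF (Dense dB) sf₂ sf₃) (1 / 25)) =
      stepPair 𝓡 (relConeLenBy 2 ℓc βf₁ sf₁ (1 / 25)) (stepPair (Dense dB) (relConeBy 2 βf₂ sf₂ (1 / 25)) (relConeBy 2 βf₃ sf₃ (1 / 25))) := by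
  rw [relConeBy_stepByF]

end FourGeneric

/-! ## §5. Instrument glue at NESTED stepped tables (B-generic) and the collar door cell from the PROVED force cap + (TFR-G κσ₁) -/

section NestedGlue

variable {𝓙 𝓗 𝓡 𝓟 : ChartFam} {𝓑 : BalPred} {ρ ε η₂ τ₀ τ₁ τ κ σ : ℝ} {T₀ T₁ T : SlackTab} {H : HessTab} {F : ForceTab} {X : SlackTab} {B₁ B₂ B₃ : PairTab}

/-- ★ On hosts OFF `𝓡` and OF `𝓟` the nested table `stepPair 𝓡 B₁ (stepPair 𝓟 B₂ B₃)` IS `B₂`. [formal bookkeeping] -/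
theorem pairKernelCert_bandLo_stepPair (h : PairKernelCert (famAnd (famAndNot 𝓙 𝓡) 𝓟) 𝓑 τ₁ T₁ κ σ H F X τ T B₂) :
    PairKernelCert (famAnd (famAndNot 𝓙 𝓡) 𝓟) 𝓑 τ₁ T₁ κ σ H F X τ T (stepPair 𝓡 B₁ (stepPair 𝓟 B₂ B₃)) :=
  pairKernelCert_congr_pair (fun _ _ _ hm a b => by rw [stepPair_of_neg hm.1.2, stepPair_of_pos hm.2]) h

/-- … and OFF `𝓡`, OFF `𝓟` it IS `B₃`. [formal bookkeeping] -/
theorem pairKernelCert_bandHi_stepPair (h : PairKernelCert (famAndNot (famAndNot 𝓙 𝓡) 𝓟) 𝓑 τ₁ T₁ κ σ H F X τ T B₃) :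
    PairKernelCert (famAndNot (famAndNot 𝓙 𝓡) 𝓟) 𝓑 τ₁ T₁ κ σ H F X τ T (stepPair 𝓡 B₁ (stepPair 𝓟 B₂ B₃)) :=
  pairKernelCert_congr_pair (fun _ _ _ hm a b => by rw [stepPair_of_neg hm.1.2, stepPair_of_neg hm.2]) h

/-- ★★ (N∣class) at a stepped table — INSTRUMENTED FORM, fully generic: identity refit, (E κ) ∧ (P₀ κ) on the family `famAnd 𝓙 𝓡` at its OWN table `B₁`, hull `𝓗 ⊇` it.
[folklore instantiation: `refineGB_of_kernelCut_top` at `pairKernelCert_stepPair_of_pos`] -/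
theorem refineGB_stepPair_of_kernelCut_top_pos (h𝓗 : FamilyLE (famAnd 𝓙 𝓡) 𝓗) (hE : SlavingEnclosureG (famAnd 𝓙 𝓡) balTop ρ ε η₂ τ₀ T₀ κ σ H F X)
    (hP : PairKernelCert (famAnd 𝓙 𝓡) balTop τ₀ T₀ κ σ H F X τ T B₁) : RefineGB (famAnd 𝓙 𝓡) 𝓗 ρ ε η₂ τ₀ T₀ τ T (stepPair 𝓡 B₁ B₂) :=
  refineGB_of_kernelCut_top h𝓗 hE (pairKernelCert_stepPair_of_pos hP)

/-- … on `famAndNot 𝓙 𝓡` at its own table `B₂`. [folklore instantiation] -/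
theorem refineGB_stepPair_of_kernelCut_top_neg (h𝓗 : FamilyLE (famAndNot 𝓙 𝓡) 𝓗) (hE : SlavingEnclosureG (famAndNot 𝓙 𝓡) balTop ρ ε η₂ τ₀ T₀ κ σ H F X)
    (hP : PairKernelCert (famAndNot 𝓙 𝓡) balTop τ₀ T₀ κ σ H F X τ T B₂) : RefineGB (famAndNot 𝓙 𝓡) 𝓗 ρ ε η₂ τ₀ T₀ τ T (stepPair 𝓡 B₁ B₂) :=
  refineGB_of_kernelCut_top h𝓗 hE (pairKernelCert_stepPair_of_neg hP)

/-- … on the low band `famAnd (famAndNot 𝓙 𝓡) 𝓟` at its own table `B₂` under the nested table. [folklore instantiation] -/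
theorem refineGB_bandLo_stepPair_of_kernelCut_top (h𝓗 : FamilyLE (famAnd (famAndNot 𝓙 𝓡) 𝓟) 𝓗)
    (hE : SlavingEnclosureG (famAnd (famAndNot 𝓙 𝓡) 𝓟) balTop ρ ε η₂ τ₀ T₀ κ σ H F X)
    (hP : PairKernelCert (famAnd (famAndNot 𝓙 𝓡) 𝓟) balTop τ₀ T₀ κ σ H F X τ T B₂) :
    RefineGB (famAnd (famAndNot 𝓙 𝓡) 𝓟) 𝓗 ρ ε η₂ τ₀ T₀ τ T (stepPair 𝓡 B₁ (stepPair 𝓟 B₂ B₃)) :=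
  refineGB_of_kernelCut_top h𝓗 hE (pairKernelCert_bandLo_stepPair hP)

/-- … on the high band `famAndNot (famAndNot 𝓙 𝓡) 𝓟` at its own table `B₃`. [folklore instantiation] -/
theorem refineGB_bandHi_stepPair_of_kernelCut_top (h𝓗 : FamilyLE (famAndNot (famAndNot 𝓙 𝓡) 𝓟) 𝓗)
    (hE : SlavingEnclosureG (famAndNot (famAndNot 𝓙 𝓡) 𝓟) balTop ρ ε η₂ τ₀ T₀ κ σ H F X)
    (hP : PairKernelCert (famAndNot (famAndNot 𝓙 𝓡) 𝓟) balTop τ₀ T₀ κ σ H F X τ T B₃) :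
    RefineGB (famAndNot (famAndNot 𝓙 𝓡) 𝓟) 𝓗 ρ ε η₂ τ₀ T₀ τ T (stepPair 𝓡 B₁ (stepPair 𝓟 B₂ B₃)) :=
  refineGB_of_kernelCut_top h𝓗 hE (pairKernelCert_bandHi_stepPair hP)

end NestedGlue

section CollarTaylor

variable {𝓘₀ 𝓗 𝓡 : ChartFam} {dA ℓc κ : ℝ} {H : HessTab} {F : ForceTab} {X : SlackTab} {B₂ : PairTab}
  {βf₁ sf₁ : (M₀ : ℕ) → (Fin M₀ → E3) → Fin M₀ → ℝ}

/-- ★★ **(N∣𝔇′)ᴸ FROM THE PROVED FORCE CAP (`forceCapOne`) ∧ (TFR-G κσ₁) ∧ (P₀ κ) AT THE COLLARED CONE** — the collar edition of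
`…KernelCutSector.refineGB_ND_of_taylor_top`. [folklore instantiation: §3 at `slavingEnclosureG_of_taylor`] -/
theorem refineGB_ND_collar_of_taylor_top (h𝓗 : FamilyLE (famAnd (famAnd 𝓘₀ (Dense dA)) 𝓡) 𝓗)
    (hT : ForceTaylorBoundG (famAnd (famAnd 𝓘₀ (Dense dA)) 𝓡) balTop (26 / 5) (1 / 100) (1 / 8) (1 / 25) (constTol (1 / 25)) (κ * sigmaOne) H F X)
    (hP : PairKernelCert (famAnd (famAnd 𝓘₀ (Dense dA)) 𝓡) balTop (1 / 25) (constTol (1 / 25)) κ sigmaOne H F X (1 / 25) (constTol (1 / 25))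
      (relConeLenBy 2 ℓc βf₁ sf₁ (1 / 25))) :
    RefineGB (famAnd (famAnd 𝓘₀ (Dense dA)) 𝓡) 𝓗 (26 / 5) (1 / 100) (1 / 8) (1 / 25) (constTol (1 / 25)) (1 / 25) (constTol (1 / 25))
      (stepPair 𝓡 (relConeLenBy 2 ℓc βf₁ sf₁ (1 / 25)) B₂) :=
  refineGB_ND_collar_of_kernelCut_top h𝓗 (slavingEnclosureG_of_taylor hT) hP

end CollarTaylor

end Summit.AtomisticToContinuum.Crystallization.Theorems.FrustratedLawDichotomyAperiodicGapRecordJunctionFourSectorCollar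

end
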